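import Mathlib
import HarnessLib
import Summits.HubbardSuperconductivity.HubbardSuperconductivity.Theorems.KLProgrammeKLRegimeCountertermJacksonRemainderStructured
import Summits.HubbardSuperconductivity.HubbardSuperconductivity.Theorems.KLProgrammeKLRegimeCountertermJacksonRemainderFlow

/-!
# Route `KLProgramme`, crux K3 — gen-8 ENGINE-FLOW child (stmt-HubbardSuperconductivity-20437 `KLRegimeEngineV17F2`), stub (C)
# `stub_twoLeg_curvature`: the (C1) JACKSON-REMAINDER DOOR v2, part 3 — the FLOW INSTANCE in mixed-moment form

Seat hubbard-kl-k3c3-p1 (g6).  The (C1) object of k3c3-p3's currency contract (`readResidue_flow_hP`, p533029) is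
`J(θ) = ν_n(K_n)(θ) − (klFlowPiece n).eval (k_F^{K′} θ)` with `K′ = K_{n+1}`; by k3c3-p1 g5 (`flowPiece_eval_sub_eq_neg_jhigh1`) it IS the Jackson
remainder `(F − 𝒥_d F)∘ofLp∘γ` of `F = klFrameExtFn μ f` (`f = ν_n(K_n)`, `d = klFlowDeg n`) read along `γ = toLp ∘ k_F^{K′}`.  This file instantiates
part 2's MIXED-MOMENT theorem (`abs_iteratedDeriv_jhigh1_comp_curve_le_mixedMoments`) at these objects:
* §1 `contDiff_klFlatCutoffFn_ofLp` (the flat cutoff is smooth on `Momentum`), `klFrameExtFn_ofLp_eq_mean_add_cutoff_mul` (the mean-free product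
  structure `E_μ f = mean f + χ·A` with the bundle's own angular factor — `rfl`), `contDiff_angularFactor_comp_curve_sub` (that factor is `C⁴` along
  displaced curves inside the open central cell off the origin), `jacksonObject_eq_jhigh1_comp_curve` (`J = (F − 𝒥_dF)∘ofLp∘γ`);
* §2 **`flowPiece_reading_remainder_jets_mixedMoments`** — for `k ≤ 4`: `|∂ᵏJ(θ)| ≤ Σ_{i≤k} C(k,i)·Mx i + Tm + S·π³/((d+1)δ₂)³`, where `Mx i` bound the
  MIXED cutoff-defect × displaced-angular-factor moments `∫J̃J̃·cdef i·adef (k−i)`, `Tm` the transport moment, `S` the displaced difference off the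
  sub-square `|s|,|t| ≤ δ₂` (take `δ₂ = π` for none) — the angular factor `A` is ANY function with `E_μ f ∘ ofLp = mean f + χ·A` that is `C⁴` along the
  displaced curves of the sub-square (the bundle's `(f − mean f)∘polarAngle∘centredRep` for small `δ₂`; a periodised smooth copy for `δ₂ = π`).
The moments are the (C)-line certificate's targets (evidence #38 `C1-CUTOFF-DEFECT-MOMENTS.md` on 20437: they close d ≥ 512 at every order and
d = 128 up to the order-4 budget question stated there).  Proofs only; no definitions; nothing about the model beyond unfolding; nothing here
asserts superconductivity.
-/

noncomputable section

namespace Summit.HubbardSuperconductivity.HubbardSuperconductivity.Theorems.KLRegimeSplit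

set_option linter.dupNamespace false -- summit = problem name (single-conjunct summit), D-0017

open Real MeasureTheory Filter
open Literature.Analysis.Fourier.TrigApprox Literature.MathematicalPhysics.QuantumLattice
open Summit.HubbardSuperconductivity.HubbardSuperconductivity.Theorems.PerturbedFermiCurve

/-! ## §1 The structure of the flow objects -/

section Structure

/-- **The flat cutoff is smooth on `Momentum`.** -/
theorem contDiff_klFlatCutoffFn_ofLp (μ : ℝ) {N : ℕ∞} :
    ContDiff ℝ N (fun q : EuclideanSpace ℝ (Fin 2) => klFlatCutoffFn μ (WithLp.ofLp q)) := by
  have e : (fun q : EuclideanSpace ℝ (Fin 2) => klFlatCutoffFn μ (WithLp.ofLp q)) =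
      (fun u : ℝ => 1 - salmhoferCutoff (100 * (u - μ) ^ 2)) ∘ fun q : EuclideanSpace ℝ (Fin 2) => sqDispersion (WithLp.ofLp q) := by
    funext q
    simp only [Function.comp_apply, klFlatCutoffFn, div_four_klFlatR_sq, freeBandFn_eq_sqDispersion]
  rw [e]
  exact (contDiff_flatProfile μ).comp contDiff_sqDispersion_ofLp

/-- **The mean-free product structure of the G-extension with the bundle's own angular factor**:
`E_μ f (q) = mean f + χ_flat(q)·(f(angle q̃) − mean f)`. -/
theorem klFrameExtFn_ofLp_eq_mean_add_cutoff_mul (μ : ℝ) (f : ℝ → ℝ) (q : EuclideanSpace ℝ (Fin 2)) :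
    klFrameExtFn μ f (WithLp.ofLp q) =
      klAngularMean f + klFlatCutoffFn μ (WithLp.ofLp q) * (f (polarAngle (centredRep (WithLp.ofLp q))) - klAngularMean f) := rfl

/-- **The bundle's own angular factor is `C⁴` along every displaced curve that stays in the open central cell and off the origin**
(so `hAv` of §2 holds for it on a small sub-square; there `centredRep` is the identity and `f∘polarAngle` is smooth off the origin). -/
theorem contDiff_angularFactor_comp_curve_sub {f : ℝ → ℝ} (hf : ContDiff ℝ 4 f) (hper : Function.Periodic f (2 * Real.pi))
    {γ : ℝ → EuclideanSpace ℝ (Fin 2)} (hγ : ContDiff ℝ 4 γ) (v : EuclideanSpace ℝ (Fin 2))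
    (hcell : ∀ ϑ : ℝ, ∀ i, |WithLp.ofLp (γ ϑ - v) i| < π) (hne : ∀ ϑ : ℝ, γ ϑ - v ≠ 0) :
    ContDiff ℝ 4 (fun ϑ : ℝ => f (polarAngle (centredRep (WithLp.ofLp (γ ϑ - v)))) - klAngularMean f) := by
  have e : (fun ϑ : ℝ => f (polarAngle (centredRep (WithLp.ofLp (γ ϑ - v)))) - klAngularMean f) =
      fun ϑ : ℝ => ((fun q : EuclideanSpace ℝ (Fin 2) => f (polarAngle (WithLp.ofLp q))) ∘ fun ϑ : ℝ => γ ϑ - v) ϑ - klAngularMean f := by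
    funext ϑ; rw [Function.comp_apply, centredRep_eq_self_of_abs_lt (hcell ϑ)]
  rw [e]
  refine ContDiff.sub (contDiff_iff_contDiffAt.mpr fun ϑ => ?_) contDiff_const
  have hγv : ContDiffAt ℝ 4 (fun ϑ : ℝ => γ ϑ - v) ϑ := (hγ.sub contDiff_const).contDiffAt
  exact ContDiffAt.comp (f := fun ϑ : ℝ => γ ϑ - v) (g := fun q : EuclideanSpace ℝ (Fin 2) => f (polarAngle (WithLp.ofLp q))) ϑ
    (contDiffAt_comp_polarAngle_ofLp hf hper (hne ϑ)) hγv

variable {L M : ℕ} [NeZero L] [NeZero M]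

/-- **The (C1) object IS the Jackson remainder along the new curve**: `ν_n(K_n)(θ) − (klFlowPiece n).eval(k_F^{K′}θ) = [(F − 𝒥_dF)∘ofLp∘γ](θ)`. -/
theorem jacksonObject_eq_jhigh1_comp_curve (β U : ℝ) {μ : ℝ} (hμ : μ ∈ klWindowC) (n : ℕ) (K' : TrigPolyC4v)
    (hf : ContDiff ℝ 4 fun θ : ℝ => klLocalPart L M β U μ (klFlowFrameU L M β U μ n) n θ)
    (hon : ∀ θ, klFrameExtFn μ (fun θ => klLocalPart L M β U μ (klFlowFrameU L M β U μ n) n θ) (klFermiPoint μ K' θ) =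
      klLocalPart L M β U μ (klFlowFrameU L M β U μ n) n θ) :
    (fun θ => klLocalPart L M β U μ (klFlowFrameU L M β U μ n) n θ - (klFlowPiece L M β U μ n).eval (klFermiPoint μ K' θ)) =
      (fun q : EuclideanSpace ℝ (Fin 2) =>
        jhigh1 (klFlowDeg n) (klFrameExtFn μ fun θ => klLocalPart L M β U μ (klFlowFrameU L M β U μ n) n θ) (WithLp.ofLp q)) ∘
          fun θ => (WithLp.toLp 2 (klFermiPoint μ K' θ) : EuclideanSpace ℝ (Fin 2)) := by
  have h := flowPiece_eval_sub_eq_neg_jhigh1 (L := L) (M := M) β U hμ n K' hf hon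
  funext θ
  have hθ := congrFun h θ
  simp only [Function.comp_apply] at hθ ⊢
  linarith

end Structure

/-! ## §2 The flow instance of the mixed-moment door -/

section Flow

variable {L M : ℕ} [NeZero L] [NeZero M]

/-- **THE (C1) DOOR v2 AT THE FLOW PIECE, MIXED-MOMENT FORM.**  `f = ν_n(K_n)` (`C⁴`, read by its own G-extension on `K′`'s Fermi points: `hon`),
`γ = toLp ∘ k_F^{K′}` (`C⁴`) inside the flat tube (`hflat`; `klFlatCutoffFn_klFermiPoint` discharges it from `K′`'s `C²` size `≤ klFlatR`), `A` any
angular factor with `E_μ f = mean f + χ·A` on `Momentum`, `C⁴` along the displaced curves `γ − v_w` of the sub-square `|s|,|t| ≤ δ₂`; continuous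
nonnegative majorants `cdef i w ≥ |∂ⁱ[χ∘(γ−v_w) − 1](θ)|`, `adef j w ≥ |∂ʲ[A∘(γ−v_w)](θ)|`, `tdef w ≥ |∂ᵏ[A∘(γ−v_w)](θ) − ∂ᵏ[A∘γ](θ)|` there, with
mixed moments `∫J̃J̃·cdef i·adef (k−i) ≤ Mx i`, `∫J̃J̃·tdef ≤ Tm` (`d = klFlowDeg n`), and `S` bounding the displaced difference of `E_μ f` off the
sub-square.  Then `|∂ᵏ[ν_n(K_n) − (klFlowPiece n).eval ∘ k_F^{K′}](θ)| ≤ Σ_{i≤k} C(k,i)·Mx i + Tm + S·π³/((d+1)δ₂)³` (`k ≤ 4`). -/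
theorem flowPiece_reading_remainder_jets_mixedMoments (β U : ℝ) {μ : ℝ} (hμ : μ ∈ klWindowC) (n : ℕ) (K' : TrigPolyC4v)
    (hf : ContDiff ℝ 4 fun θ : ℝ => klLocalPart L M β U μ (klFlowFrameU L M β U μ n) n θ)
    (hon : ∀ θ, klFrameExtFn μ (fun θ => klLocalPart L M β U μ (klFlowFrameU L M β U μ n) n θ) (klFermiPoint μ K' θ) =
      klLocalPart L M β U μ (klFlowFrameU L M β U μ n) n θ)
    (hγ : ContDiff ℝ 4 fun θ => (WithLp.toLp 2 (klFermiPoint μ K' θ) : EuclideanSpace ℝ (Fin 2)))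
    (hflat : ∀ ϑ : ℝ, klFlatCutoffFn μ (klFermiPoint μ K' ϑ) = 1)
    {A : EuclideanSpace ℝ (Fin 2) → ℝ}
    (hA : ∀ q : EuclideanSpace ℝ (Fin 2), klFrameExtFn μ (fun θ => klLocalPart L M β U μ (klFlowFrameU L M β U μ n) n θ) (WithLp.ofLp q) =
      klAngularMean (fun θ => klLocalPart L M β U μ (klFlowFrameU L M β U μ n) n θ) + klFlatCutoffFn μ (WithLp.ofLp q) * A q)
    {k : ℕ} (hk : k ≤ 4) (θ : ℝ) {δ₂ : ℝ} (hδ₂ : 0 < δ₂) (hδ₂π : δ₂ ≤ π)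
    (hAv : ∀ w : ℝ × ℝ, |w.1| ≤ δ₂ → |w.2| ≤ δ₂ →
      ContDiff ℝ 4 (fun ϑ : ℝ => A ((WithLp.toLp 2 (klFermiPoint μ K' ϑ) : EuclideanSpace ℝ (Fin 2)) - jshift w)))
    {cdef adef : ℕ → ℝ × ℝ → ℝ} (hcdef_cont : ∀ i ≤ k, Continuous (cdef i)) (hcdef_nn : ∀ i ≤ k, ∀ w, 0 ≤ cdef i w)
    (hadef_cont : ∀ j ≤ k, Continuous (adef j)) (hadef_nn : ∀ j ≤ k, ∀ w, 0 ≤ adef j w)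
    (hcdef : ∀ w : ℝ × ℝ, |w.1| ≤ δ₂ → |w.2| ≤ δ₂ → ∀ i ≤ k,
      |iteratedDeriv i (fun ϑ : ℝ =>
        klFlatCutoffFn μ (WithLp.ofLp ((WithLp.toLp 2 (klFermiPoint μ K' ϑ) : EuclideanSpace ℝ (Fin 2)) - jshift w)) - 1) θ| ≤ cdef i w)
    (hadef : ∀ w : ℝ × ℝ, |w.1| ≤ δ₂ → |w.2| ≤ δ₂ → ∀ j ≤ k,
      |iteratedDeriv j (fun ϑ : ℝ => A ((WithLp.toLp 2 (klFermiPoint μ K' ϑ) : EuclideanSpace ℝ (Fin 2)) - jshift w)) θ| ≤ adef j w)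
    {Mx : ℕ → ℝ} (hMx : ∀ i ≤ k, ∫ w, jweight (klFlowDeg n) w * (cdef i w * adef (k - i) w) ∂jmeas ≤ Mx i)
    {tdef : ℝ × ℝ → ℝ} (htdef_cont : Continuous tdef) (htdef_nn : ∀ w, 0 ≤ tdef w)
    (ht : ∀ w : ℝ × ℝ, |w.1| ≤ δ₂ → |w.2| ≤ δ₂ →
      |iteratedDeriv k (fun ϑ : ℝ => A ((WithLp.toLp 2 (klFermiPoint μ K' ϑ) : EuclideanSpace ℝ (Fin 2)) - jshift w)) θ -
        iteratedDeriv k (fun ϑ : ℝ => A (WithLp.toLp 2 (klFermiPoint μ K' ϑ) : EuclideanSpace ℝ (Fin 2))) θ| ≤ tdef w)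
    {Tm : ℝ} (hTm : ∫ w, jweight (klFlowDeg n) w * tdef w ∂jmeas ≤ Tm)
    {S : ℝ} (hS : 0 ≤ S)
    (hfar : ∀ w ∈ Set.Icc (-π) π ×ˢ Set.Icc (-π) π, (δ₂ < |w.1| ∨ δ₂ < |w.2|) →
      |iteratedDeriv k (fun ϑ : ℝ => klFrameExtFn μ (fun θ => klLocalPart L M β U μ (klFlowFrameU L M β U μ n) n θ)
          (WithLp.ofLp ((WithLp.toLp 2 (klFermiPoint μ K' ϑ) : EuclideanSpace ℝ (Fin 2)) - jshift w))) θ -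
        iteratedDeriv k (fun ϑ : ℝ => klFrameExtFn μ (fun θ => klLocalPart L M β U μ (klFlowFrameU L M β U μ n) n θ)
          (WithLp.ofLp (WithLp.toLp 2 (klFermiPoint μ K' ϑ) : EuclideanSpace ℝ (Fin 2)))) θ| ≤ S) :
    |iteratedDeriv k (fun θ => klLocalPart L M β U μ (klFlowFrameU L M β U μ n) n θ -
        (klFlowPiece L M β U μ n).eval (klFermiPoint μ K' θ)) θ| ≤
      (∑ i ∈ Finset.range (k + 1), (k.choose i : ℝ) * Mx i) + Tm + S * (π ^ 3 / ((klFlowDeg n + 1) * δ₂) ^ 3) := by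
  set f : ℝ → ℝ := fun θ => klLocalPart L M β U μ (klFlowFrameU L M β U μ n) n θ with hfdef
  set F : (Fin 2 → ℝ) → ℝ := klFrameExtFn μ f with hFdef
  set γ : ℝ → EuclideanSpace ℝ (Fin 2) := fun θ => WithLp.toLp 2 (klFermiPoint μ K' θ) with hγdef
  have hper : Function.Periodic f (2 * Real.pi) := klLocalPart_periodic β U μ _ n
  have hG : ContDiff ℝ 4 (fun q : EuclideanSpace ℝ (Fin 2) => F (WithLp.ofLp q)) := contDiff_onM_klFrameExtFn (N := 4) hf hper hμ
  have hFc : Continuous F := continuous_klFrameExtFn_of_contDiff hG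
  have hχ : ContDiff ℝ 4 (fun q : EuclideanSpace ℝ (Fin 2) => klFlatCutoffFn μ (WithLp.ofLp q)) := contDiff_klFlatCutoffFn_ofLp μ
  have hflat' : ∀ ϑ : ℝ, (fun q : EuclideanSpace ℝ (Fin 2) => klFlatCutoffFn μ (WithLp.ofLp q)) (γ ϑ) = 1 := fun ϑ => by
    simp only [hγdef, WithLp.ofLp_toLp]; exact hflat ϑ
  rw [jacksonObject_eq_jhigh1_comp_curve (L := L) (M := M) β U hμ n K' hf hon]
  have h := abs_iteratedDeriv_jhigh1_comp_curve_le_mixedMoments (klFlowDeg n) hFc hG hγ hk θ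
    (χ := fun q : EuclideanSpace ℝ (Fin 2) => klFlatCutoffFn μ (WithLp.ofLp q)) (A := A) (m := klAngularMean f) hA hflat' hχ hδ₂ hδ₂π hAv
    hcdef_cont hcdef_nn hadef_cont hadef_nn hcdef hadef hMx htdef_cont htdef_nn ht hTm hS hfar
  have hd : ((klFlowDeg n : ℕ) : ℝ) = (klFlowDeg n : ℝ) := rfl
  simpa using h

end Flow

end Summit.HubbardSuperconductivity.HubbardSuperconductivity.Theorems.KLRegimeSplit

end
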